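/-
Copyright (c) 2026 the pub-hodgecm-mathlib formalisation cell (harness21).  Prover seat hodgecm-mathlib-K2E5-p16 (g5): Track B «K2-LIT»,
hLiu418 = stmt-HodgeConjecture-24832, ROAD Φ organ (SD-2) (arch integrals of twisted Gaussians = `ξ` in the `g`-binder), file (7b):
`t ↦ xiShift (g₀ + t•Ξ) h α β` is holomorphic on a disc `‖t‖ < r(g₀, Ξ)`; 2026-09-04.
-/
import Summits.HodgeConjecture.HodgeConjecture.Theorems.K2LiuHermTwoEtaShiftDominated        -- (7a): dominated `G`
import Summits.HodgeConjecture.HodgeConjecture.Theorems.K2LiuHermTwoXiBetaShift             -- ★ p858800: `posDef_pi_smul`, `xiShift_def` algebra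
import HarnessLib

/-!
# Crux `HLiu418`, ROAD Φ, organ (SD-2) — file (7b): holomorphy of `t ↦ xiShift (g₀ + t•Ξ) h α β` on a disc around `0`

Cell `hodgecm-mathlib`, crux item hLiu418 = `stmt-HodgeConjecture-24832`, route of record `HCCMUnconditional`; squad K2, LEAD F0P6-plan (g13)
(M-157i′, deal (SD-2)), co-dealer K2E5-plan (g6) («= RE-BASE ON THE g-BINDER»: the ONE-COMPLEX-LINE family `t ↦ xiShift (g₀ + t•Ξ) h α β`,
`g₀ > 0`, `Ξ` any complex `2 × 2` direction), prover K2E5-p16 (g5).  THEOREMS ONLY; lane `--supports stmt-HodgeConjecture-24832 --as helper`.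

WHAT.
* `exists_dominating_radius (hd₀) (Ξ)` — for `G₀ = hermTwo d₀ > 0` there is `r > 0` (depending on `G₀, Ξ` only) such that for `‖t‖ ≤ r` and every
  `x > 0`:  `‖e^{−tr(x(G₀ + tΞ))}‖ ≤ ‖e^{−tr(x·G₀∕2)}‖` and `|tr(xΞ)|·‖e^{−tr(x(G₀ + tΞ))}‖ ≤ K·‖e^{−tr(x·G₀∕4)}‖`
  (entries of `x > 0` are `≤ tr x`, `tr(xG₀) ≥ (det G₀∕tr G₀)·tr x` ★ `trace_mul_lower_bound`, `T e^{−T∕4} ≤ 4`);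
* `hasDerivAt_etaShift_param`, `differentiableOn_etaShift_param` — under those two dominations, `t ↦ etaShift (G₀ + t•Ξ) H α β` (`H > 0`,
  `re β > 0`) is complex-differentiable on `‖t‖ < r` (dominated differentiation; majorants = ★ (2)'s weighted `η`-norms at `G₀∕2`, `G₀∕4`);
* `exists_differentiableOn_xiShift_param (hg₀) (hh) (Ξ) (α) (hβ : 0 < re β)` — `∃ r > 0`, `t ↦ xiShift (g₀ + t•Ξ) h α β` holomorphic on
  `ball 0 r`, with the domination certificate for `2(g₀ + tΞ)` by `g₀` on `‖t‖ ≤ r` exported for the growth∕Cauchy files (7c)∕(7d).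
HONEST LABEL.  Count-neutral helper of the K2_Liu road; it pays no socket by itself: `HC_CM` is proved only modulo the 7 printed citations
(2 remaining named inputs: hLiu418 = `stmt-HodgeConjecture-24832`, h413 = `stmt-HodgeConjecture-24833`) until rung 0 closes.
-/

set_option autoImplicit false
-- the mandated namespace repeats the single-problem summit's segment (`HodgeConjecture.HodgeConjecture`)
set_option linter.dupNamespace false

noncomputable section

open Complex MeasureTheory Set
open scoped ComplexOrder ComplexConjugate

namespace Summit.HodgeConjecture.HodgeConjecture.Cruxes.HLiu418.K2LiuHermTwoXiShiftParamHolomorphy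

open Summit.HodgeConjecture.HodgeConjecture.Cruxes.HLiu418.K2LiuHermTwoGammaDefs
open Summit.HodgeConjecture.HodgeConjecture.Cruxes.HLiu418.K2LiuHermTwoEtaDefs
open Summit.HodgeConjecture.HodgeConjecture.Cruxes.HLiu418.K2LiuHermTwoEtaConvergence
open Summit.HodgeConjecture.HodgeConjecture.Cruxes.HLiu418.K2LiuHermTwoXiEtaIdentity
open Summit.HodgeConjecture.HodgeConjecture.Cruxes.HLiu418.K2LiuHermTwoEtaShiftDefs
open Summit.HodgeConjecture.HodgeConjecture.Cruxes.HLiu418.K2LiuHermTwoEtaShiftConvergence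
open Summit.HodgeConjecture.HodgeConjecture.Cruxes.HLiu418.K2LiuHermTwoEtaShiftDominated
open Summit.HodgeConjecture.HodgeConjecture.Cruxes.HLiu418.K2LiuHermTwoXiBetaShift

/-! ## Traces against an arbitrary direction -/

/-- `tr(x·Ξ)` in the chart `x = [[a, z],[z̄, b]]`. -/
theorem trace_hermTwo_mul (c : ℝ × ℂ × ℝ) (Ξ : Matrix (Fin 2) (Fin 2) ℂ) :
    (hermTwo c * Ξ).trace = (c.1 : ℂ) * Ξ 0 0 + c.2.1 * Ξ 1 0 + (conj c.2.1 * Ξ 0 1 + (c.2.2 : ℂ) * Ξ 1 1) := by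
  rw [Matrix.trace_fin_two, Matrix.mul_apply, Matrix.mul_apply, Fin.sum_univ_two, Fin.sum_univ_two]
  simp [hermTwo]

/-- For `x > 0`: `|tr(x Ξ)| ≤ tr(x) · Σ |Ξ_{jk}|` (entries of a positive definite `2 × 2` matrix are bounded by its trace). -/
theorem norm_trace_hermTwo_mul_le {c : ℝ × ℂ × ℝ} (hc : 0 < c.1 ∧ normSq c.2.1 < c.1 * c.2.2) (Ξ : Matrix (Fin 2) (Fin 2) ℂ) :
    ‖(hermTwo c * Ξ).trace‖ ≤ (c.1 + c.2.2) * (‖Ξ 0 0‖ + ‖Ξ 1 0‖ + ‖Ξ 0 1‖ + ‖Ξ 1 1‖) := by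
  obtain ⟨ha, hz⟩ := hc
  have hb : 0 < c.2.2 := snd_pos_of_cone ha hz
  have hzle : ‖c.2.1‖ ≤ c.1 + c.2.2 := by
    have hs0 : 0 ≤ ‖c.2.1‖ := norm_nonneg _
    have hs2 : ‖c.2.1‖ ^ 2 < c.1 * c.2.2 := by rw [Complex.sq_norm]; exact hz
    nlinarith [sq_nonneg (c.1 - c.2.2)]
  have ha' : ‖(c.1 : ℂ)‖ ≤ c.1 + c.2.2 := by rw [Complex.norm_real, Real.norm_of_nonneg ha.le]; linarith
  have hb' : ‖(c.2.2 : ℂ)‖ ≤ c.1 + c.2.2 := by rw [Complex.norm_real, Real.norm_of_nonneg hb.le]; linarith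
  have hzc : ‖conj c.2.1‖ ≤ c.1 + c.2.2 := by rw [Complex.norm_conj]; exact hzle
  rw [trace_hermTwo_mul]
  have hT : 0 ≤ c.1 + c.2.2 := by linarith
  calc ‖(c.1 : ℂ) * Ξ 0 0 + c.2.1 * Ξ 1 0 + (conj c.2.1 * Ξ 0 1 + (c.2.2 : ℂ) * Ξ 1 1)‖
      ≤ ‖(c.1 : ℂ) * Ξ 0 0‖ + ‖c.2.1 * Ξ 1 0‖ + (‖conj c.2.1 * Ξ 0 1‖ + ‖(c.2.2 : ℂ) * Ξ 1 1‖) :=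
        (norm_add_le _ _).trans (add_le_add (norm_add_le _ _) (norm_add_le _ _))
    _ ≤ (c.1 + c.2.2) * ‖Ξ 0 0‖ + (c.1 + c.2.2) * ‖Ξ 1 0‖ + ((c.1 + c.2.2) * ‖Ξ 0 1‖ + (c.1 + c.2.2) * ‖Ξ 1 1‖) := by
        simp only [norm_mul]
        gcongr
    _ = (c.1 + c.2.2) * (‖Ξ 0 0‖ + ‖Ξ 1 0‖ + ‖Ξ 0 1‖ + ‖Ξ 1 1‖) := by ring

/-- `tr(x(G₀ + tΞ)) = tr(xG₀) + t·tr(xΞ)`. -/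
theorem trace_mul_param (x G₀ Ξ : Matrix (Fin 2) (Fin 2) ℂ) (t : ℂ) :
    (x * (G₀ + t • Ξ)).trace = (x * G₀).trace + t * (x * Ξ).trace := by
  rw [Matrix.mul_add, Matrix.mul_smul, Matrix.trace_add, Matrix.trace_smul, smul_eq_mul]

/-- The `(0,0)` entry along the line: `(G₀ + tΞ)₀₀ = (G₀)₀₀ + t Ξ₀₀`. -/
theorem apply_param (G₀ Ξ : Matrix (Fin 2) (Fin 2) ℂ) (t : ℂ) : (G₀ + t • Ξ) 0 0 = G₀ 0 0 + t * Ξ 0 0 := by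
  simp [Matrix.add_apply, Matrix.smul_apply]

/-! ## The domination radius -/

/-- **THE DOMINATION RADIUS**: for `G₀ = hermTwo d₀ > 0` and any direction `Ξ` there are `r > 0` and `K ≥ 0` such that for every `‖t‖ ≤ r` and
every `x = hermTwo c > 0`:  `‖e^{−tr(x(G₀+tΞ))}‖ ≤ ‖e^{−tr(x·G₀∕2)}‖` and `|tr(xΞ)|·‖e^{−tr(x(G₀+tΞ))}‖ ≤ K·‖e^{−tr(x·G₀∕4)}‖`. -/
theorem exists_dominating_radius {d₀ : ℝ × ℂ × ℝ} (hd₀ : 0 < d₀.1 ∧ normSq d₀.2.1 < d₀.1 * d₀.2.2) (Ξ : Matrix (Fin 2) (Fin 2) ℂ) :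
    ∃ r K : ℝ, 0 < r ∧ 0 ≤ K ∧ ∀ t : ℂ, ‖t‖ ≤ r → ∀ c : ℝ × ℂ × ℝ, (0 < c.1 ∧ normSq c.2.1 < c.1 * c.2.2) →
      ‖cexp (-(hermTwo c * (hermTwo d₀ + t • Ξ)).trace)‖ ≤ ‖cexp (-(hermTwo c * hermTwo ((1 / 2 : ℝ) • d₀)).trace)‖ ∧
      ‖(hermTwo c * Ξ).trace‖ * ‖cexp (-(hermTwo c * (hermTwo d₀ + t • Ξ)).trace)‖ ≤
        K * ‖cexp (-(hermTwo c * hermTwo ((1 / 4 : ℝ) • d₀)).trace)‖ := by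
  have hq : 0 < d₀.2.2 := snd_pos_of_cone hd₀.1 hd₀.2
  set c₀ : ℝ := (d₀.1 * d₀.2.2 - normSq d₀.2.1) / (d₀.1 + d₀.2.2) with hc₀
  have hc₀pos : 0 < c₀ := div_pos (by linarith [hd₀.2]) (by linarith [hd₀.1])
  set S : ℝ := ‖Ξ 0 0‖ + ‖Ξ 1 0‖ + ‖Ξ 0 1‖ + ‖Ξ 1 1‖ with hS
  have hS0 : 0 ≤ S := by positivity
  refine ⟨c₀ / (2 * S + 1), 4 * S / c₀, by positivity, by positivity, fun t ht c hc => ?_⟩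
  have hb : 0 < c.2.2 := snd_pos_of_cone hc.1 hc.2
  -- the real trace `T = tr(x G₀) ≥ c₀ tr x`
  set T : ℝ := c.1 * d₀.1 + c.2.2 * d₀.2.2 + 2 * (c.2.1 * conj d₀.2.1).re with hT
  have hlow := trace_mul_lower_bound hc.1 hc.2 hd₀.1 hd₀.2
  have htr0 : 0 ≤ c.1 + c.2.2 := by linarith [hc.1]
  have hTge : c₀ * (c.1 + c.2.2) ≤ T := by
    rw [hc₀, hT, div_mul_eq_mul_div, div_le_iff₀ (by linarith [hd₀.1])]
    linarith
  have hT0 : 0 ≤ T := le_trans (mul_nonneg hc₀pos.le htr0) hTge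
  -- `|t·tr(xΞ)| ≤ T/2`
  have hΞ := norm_trace_hermTwo_mul_le hc Ξ
  have htS : ‖t‖ * S ≤ c₀ / 2 := by
    have h1 : ‖t‖ * S ≤ c₀ / (2 * S + 1) * S := mul_le_mul_of_nonneg_right ht hS0
    have h2 : c₀ / (2 * S + 1) * S ≤ c₀ / 2 := by
      rw [div_mul_eq_mul_div, div_le_div_iff₀ (by positivity) (by norm_num)]
      nlinarith
    linarith
  have hre : ‖t * (hermTwo c * Ξ).trace‖ ≤ T / 2 := by
    rw [norm_mul]
    calc ‖t‖ * ‖(hermTwo c * Ξ).trace‖ ≤ ‖t‖ * ((c.1 + c.2.2) * S) := mul_le_mul_of_nonneg_left hΞ (norm_nonneg _)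
      _ = (‖t‖ * S) * (c.1 + c.2.2) := by ring
      _ ≤ (c₀ / 2) * (c.1 + c.2.2) := mul_le_mul_of_nonneg_right htS htr0
      _ ≤ T / 2 := by linarith
  -- the norms of the three exponentials
  have hG : ‖cexp (-(hermTwo c * (hermTwo d₀ + t • Ξ)).trace)‖ ≤ Real.exp (-(T / 2)) := by
    rw [Complex.norm_exp, trace_mul_param, trace_hermTwo_mul_hermTwo]
    refine Real.exp_le_exp.mpr ?_
    have h1 : -(t * (hermTwo c * Ξ).trace).re ≤ T / 2 := le_trans (neg_le_abs _) ((Complex.abs_re_le_norm _).trans hre)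
    simp only [neg_add_rev, add_re, neg_re, ofReal_re]
    linarith
  have hhalf : ‖cexp (-(hermTwo c * hermTwo ((1 / 2 : ℝ) • d₀)).trace)‖ = Real.exp (-(T / 2)) := by
    rw [Complex.norm_exp, trace_hermTwo_mul_hermTwo]
    congr 1
    simp only [Prod.smul_fst, Prod.smul_snd, smul_eq_mul, Complex.real_smul, neg_re, ofReal_re, hT, map_mul, Complex.conj_ofReal,
      Complex.mul_re, Complex.mul_im, Complex.ofReal_re, Complex.ofReal_im, zero_mul, sub_zero]
    ring
  have hquart : ‖cexp (-(hermTwo c * hermTwo ((1 / 4 : ℝ) • d₀)).trace)‖ = Real.exp (-(T / 4)) := by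
    rw [Complex.norm_exp, trace_hermTwo_mul_hermTwo]
    congr 1
    simp only [Prod.smul_fst, Prod.smul_snd, smul_eq_mul, Complex.real_smul, neg_re, ofReal_re, hT, map_mul, Complex.conj_ofReal,
      Complex.mul_re, Complex.mul_im, Complex.ofReal_re, Complex.ofReal_im, zero_mul, sub_zero]
    ring
  refine ⟨by rw [hhalf]; exact hG, ?_⟩
  rw [hquart]
  -- `|tr(xΞ)| e^{−T/2} ≤ S tr(x) e^{−T/2} ≤ (S/c₀) T e^{−T/2} ≤ (4S/c₀) e^{−T/4}`
  have hTe : T * Real.exp (-(T / 4)) ≤ 4 := by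
    have h1 : 1 + T / 4 ≤ Real.exp (T / 4) := by linarith [Real.add_one_le_exp (T / 4)]
    have h2 : Real.exp (-(T / 4)) * Real.exp (T / 4) = 1 := by rw [← Real.exp_add, neg_add_cancel, Real.exp_zero]
    nlinarith [Real.exp_pos (-(T / 4)), Real.exp_pos (T / 4)]
  calc ‖(hermTwo c * Ξ).trace‖ * ‖cexp (-(hermTwo c * (hermTwo d₀ + t • Ξ)).trace)‖
      ≤ ((c.1 + c.2.2) * S) * Real.exp (-(T / 2)) := mul_le_mul hΞ hG (norm_nonneg _) (by positivity)
    _ ≤ (T / c₀ * S) * Real.exp (-(T / 2)) := by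
        refine mul_le_mul_of_nonneg_right (mul_le_mul_of_nonneg_right ?_ hS0) (Real.exp_pos _).le
        rw [le_div_iff₀ hc₀pos]
        linarith
    _ = S / c₀ * (T * Real.exp (-(T / 4))) * Real.exp (-(T / 4)) := by
        rw [show -(T / 2) = -(T / 4) + -(T / 4) by ring, Real.exp_add]
        ring
    _ ≤ S / c₀ * 4 * Real.exp (-(T / 4)) :=
        mul_le_mul_of_nonneg_right (mul_le_mul_of_nonneg_left hTe (by positivity)) (Real.exp_pos _).le
    _ = 4 * S / c₀ * Real.exp (-(T / 4)) := by ring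

/-! ## Holomorphy of `t ↦ etaShift (G₀ + t•Ξ) H α β` -/

/-- The shifted integrand along the line `G₀ + tΞ`, as a function of `t`. -/
theorem etaShiftIntegrand_param (G₀ Ξ H : Matrix (Fin 2) (Fin 2) ℂ) (α β : ℂ) (c : ℝ × ℂ × ℝ) (t : ℂ) :
    etaShiftIntegrand (G₀ + t • Ξ) H α β c =
      (G₀ 0 0 + t * Ξ 0 0 - (α - 2) * ((hermTwo c + H) 1 1 / (hermTwo c + H).det)) / (hermTwo c - H) 1 1 *
        (cexp (-(hermTwo c * G₀).trace + -(t * (hermTwo c * Ξ).trace)) * ((hermTwo c + H).det ^ (α - 2) * (hermTwo c - H).det ^ (β + 1 - 2))) := by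
  rw [etaShiftIntegrand_eq, apply_param, trace_mul_param, neg_add]

/-- The `t`-derivative of the shifted integrand along the line:
`Ξ₀₀∕(x−H)₁₁ · η-integrand(G₀+tΞ; α, β+1) − tr(xΞ) · etaShiftIntegrand(G₀+tΞ; α, β)`. -/
theorem hasDerivAt_etaShiftIntegrand_param (G₀ Ξ H : Matrix (Fin 2) (Fin 2) ℂ) (α β : ℂ) (c : ℝ × ℂ × ℝ) (t : ℂ) :
    HasDerivAt (fun t : ℂ => etaShiftIntegrand (G₀ + t • Ξ) H α β c)
      (Ξ 0 0 / (hermTwo c - H) 1 1 * etaTwoIntegrand (G₀ + t • Ξ) H α (β + 1) c +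
        -(hermTwo c * Ξ).trace * etaShiftIntegrand (G₀ + t • Ξ) H α β c) t := by
  have hfun : (fun t : ℂ => etaShiftIntegrand (G₀ + t • Ξ) H α β c) = fun t =>
      (G₀ 0 0 + t * Ξ 0 0 - (α - 2) * ((hermTwo c + H) 1 1 / (hermTwo c + H).det)) / (hermTwo c - H) 1 1 *
        (cexp (-(hermTwo c * G₀).trace + -(t * (hermTwo c * Ξ).trace)) * ((hermTwo c + H).det ^ (α - 2) * (hermTwo c - H).det ^ (β + 1 - 2))) :=
    funext fun t => etaShiftIntegrand_param G₀ Ξ H α β c t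
  rw [hfun]
  have hW : HasDerivAt (fun t : ℂ => (G₀ 0 0 + t * Ξ 0 0 - (α - 2) * ((hermTwo c + H) 1 1 / (hermTwo c + H).det)) / (hermTwo c - H) 1 1)
      (Ξ 0 0 / (hermTwo c - H) 1 1) t := by
    have h1 : HasDerivAt (fun t : ℂ => G₀ 0 0 + t * Ξ 0 0 - (α - 2) * ((hermTwo c + H) 1 1 / (hermTwo c + H).det)) (Ξ 0 0) t := by
      simpa using (((hasDerivAt_id t).mul_const (Ξ 0 0)).const_add (G₀ 0 0)).sub_const ((α - 2) * ((hermTwo c + H) 1 1 / (hermTwo c + H).det))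
    exact h1.div_const _
  have hE : HasDerivAt (fun t : ℂ => cexp (-(hermTwo c * G₀).trace + -(t * (hermTwo c * Ξ).trace)) *
      ((hermTwo c + H).det ^ (α - 2) * (hermTwo c - H).det ^ (β + 1 - 2)))
      (cexp (-(hermTwo c * G₀).trace + -(t * (hermTwo c * Ξ).trace)) * (-(hermTwo c * Ξ).trace) *
        ((hermTwo c + H).det ^ (α - 2) * (hermTwo c - H).det ^ (β + 1 - 2))) t := by
    have h1 : HasDerivAt (fun t : ℂ => -(hermTwo c * G₀).trace + -(t * (hermTwo c * Ξ).trace)) (-(hermTwo c * Ξ).trace) t := by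
      simpa using (((hasDerivAt_id t).mul_const ((hermTwo c * Ξ).trace)).neg).const_add (-(hermTwo c * G₀).trace)
    exact h1.cexp.mul_const _
  refine (hW.mul hE).congr_deriv ?_
  rw [etaShiftIntegrand_param, etaTwoIntegrand_apply, trace_mul_param, neg_add]
  ring

/-- **`t ↦ etaShift (G₀ + t•Ξ) H α β` IS COMPLEX-DIFFERENTIABLE ON THE DOMINATION DISC** (`G₀ = hermTwo d₀ > 0`, `H > 0`, `re β > 0`; the two
dominations of `exists_dominating_radius` on `‖t‖ ≤ r` are the hypotheses). -/
theorem hasDerivAt_etaShift_param {d₀ : ℝ × ℂ × ℝ} (hd₀ : 0 < d₀.1 ∧ normSq d₀.2.1 < d₀.1 * d₀.2.2) (Ξ : Matrix (Fin 2) (Fin 2) ℂ)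
    {H : Matrix (Fin 2) (Fin 2) ℂ} (hH : H.PosDef) {r K : ℝ}
    (hdom : ∀ t : ℂ, ‖t‖ ≤ r → ∀ c : ℝ × ℂ × ℝ, (0 < c.1 ∧ normSq c.2.1 < c.1 * c.2.2) →
      ‖cexp (-(hermTwo c * (hermTwo d₀ + t • Ξ)).trace)‖ ≤ ‖cexp (-(hermTwo c * hermTwo ((1 / 2 : ℝ) • d₀)).trace)‖ ∧
      ‖(hermTwo c * Ξ).trace‖ * ‖cexp (-(hermTwo c * (hermTwo d₀ + t • Ξ)).trace)‖ ≤
        K * ‖cexp (-(hermTwo c * hermTwo ((1 / 4 : ℝ) • d₀)).trace)‖)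
    (α : ℂ) {β : ℂ} (hβ : 0 < β.re) {t₀ : ℂ} (ht₀ : ‖t₀‖ < r) :
    HasDerivAt (fun t : ℂ => etaShift (hermTwo d₀ + t • Ξ) H α β)
      (∫ c in etaTwoSet H, (Ξ 0 0 / (hermTwo c - H) 1 1 * etaTwoIntegrand (hermTwo d₀ + t₀ • Ξ) H α (β + 1) c +
        -(hermTwo c * Ξ).trace * etaShiftIntegrand (hermTwo d₀ + t₀ • Ξ) H α β c)) t₀ := by
  have hfun : (fun t : ℂ => etaShift (hermTwo d₀ + t • Ξ) H α β) = fun t => ∫ c in etaTwoSet H, etaShiftIntegrand (hermTwo d₀ + t • Ξ) H α β c :=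
    funext fun t => etaShift_def _ H _ _
  rw [hfun]
  obtain ⟨e, rfl⟩ : ∃ e : ℝ × ℂ × ℝ, hermTwo e = H := ⟨_, hermTwo_eq_of_isHermitian hH.1⟩
  have hβ1 : 1 < (β + 1).re := by simp only [add_re, one_re]; linarith
  have hg2 : (hermTwo ((1 / 2 : ℝ) • d₀)).PosDef := posDef_hermTwo_smul (by norm_num) ((posDef_hermTwo_iff d₀).mpr hd₀)
  have hg4 : (hermTwo ((1 / 4 : ℝ) • d₀)).PosDef := posDef_hermTwo_smul (by norm_num) ((posDef_hermTwo_iff d₀).mpr hd₀)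
  -- the radius of the neighbourhood of `t₀` inside the domination disc
  set ε : ℝ := r - ‖t₀‖ with hε
  have hεpos : 0 < ε := by rw [hε]; linarith
  have hball : ∀ t ∈ Metric.ball t₀ ε, ‖t‖ ≤ r := by
    intro t ht
    have h1 : ‖t‖ ≤ ‖t - t₀‖ + ‖t₀‖ := by
      have := norm_add_le (t - t₀) t₀
      rwa [sub_add_cancel] at this
    rw [hε] at ht
    have h2 : ‖t - t₀‖ < r - ‖t₀‖ := mem_ball_iff_norm.mp ht
    linarith
  -- on the domain every point is in the cone
  have hcone : ∀ c ∈ etaTwoSet (hermTwo e), 0 < c.1 ∧ normSq c.2.1 < c.1 * c.2.2 := by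
    intro c hc
    obtain ⟨-, hcm⟩ := (mem_etaTwoSet_iff (hermTwo e) c).mp hc
    have hx : (hermTwo c).PosDef := by
      have := hcm.add_posSemidef hH.posSemidef
      rwa [sub_add_cancel] at this
    exact (posDef_hermTwo_iff c).mp hx
  -- constants of the weight bound along the disc
  have h2e := (posDef_hermTwo_iff (e + e)).mp (by rw [hermTwo_add]; exact hH.add hH)
  set δ : ℝ := (e + e).1 * (e + e).2.2 - normSq (e + e).2.1 with hδdef
  have hδ : 0 < δ := by rw [hδdef]; linarith [h2e.2]
  have he3 : 0 < e.2.2 := by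
    have hee := (posDef_hermTwo_iff e).mp hH
    exact snd_pos_of_cone hee.1 hee.2
  set A : ℝ := ‖hermTwo d₀ 0 0‖ + r * ‖Ξ 0 0‖ + 2 * e.2.2 * ‖α - 2‖ / δ with hA
  set B : ℝ := ‖α - 2‖ / δ with hB
  have hr0 : 0 ≤ r := le_trans (norm_nonneg _) ht₀.le
  have hA0 : 0 ≤ A := by positivity
  have hB0 : 0 ≤ B := by positivity
  -- the four integrable majorant pieces
  have hW2 : IntegrableOn (fun c : ℝ × ℂ × ℝ => ‖((hermTwo c - hermTwo e) 1 1)⁻¹‖ *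
      ‖etaTwoIntegrand (hermTwo ((1 / 2 : ℝ) • d₀)) (hermTwo e) α (β + 1) c‖) (etaTwoSet (hermTwo e)) := by
    have h := (integrableOn_inv_mul_etaTwoIntegrand_of_posDef hg2 hH α hβ1).norm
    rw [IntegrableOn]
    simpa only [norm_mul] using h
  have hW4 : IntegrableOn (fun c : ℝ × ℂ × ℝ => ‖((hermTwo c - hermTwo e) 1 1)⁻¹‖ *
      ‖etaTwoIntegrand (hermTwo ((1 / 4 : ℝ) • d₀)) (hermTwo e) α (β + 1) c‖) (etaTwoSet (hermTwo e)) := by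
    have h := (integrableOn_inv_mul_etaTwoIntegrand_of_posDef hg4 hH α hβ1).norm
    rw [IntegrableOn]
    simpa only [norm_mul] using h
  have hN4 := (integrableOn_etaTwoIntegrand_of_posDef hg4 hH α hβ1).norm
  refine (hasDerivAt_integral_of_dominated_loc_of_deriv_le (μ := (volume : Measure (ℝ × ℂ × ℝ)).restrict (etaTwoSet (hermTwo e)))
    (F := fun t c => etaShiftIntegrand (hermTwo d₀ + t • Ξ) (hermTwo e) α β c)
    (F' := fun t c => Ξ 0 0 / (hermTwo c - hermTwo e) 1 1 * etaTwoIntegrand (hermTwo d₀ + t • Ξ) (hermTwo e) α (β + 1) c +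
      -(hermTwo c * Ξ).trace * etaShiftIntegrand (hermTwo d₀ + t • Ξ) (hermTwo e) α β c)
    (bound := fun c => ‖Ξ 0 0‖ * (‖((hermTwo c - hermTwo e) 1 1)⁻¹‖ * ‖etaTwoIntegrand (hermTwo ((1 / 2 : ℝ) • d₀)) (hermTwo e) α (β + 1) c‖) +
      K * A * (‖((hermTwo c - hermTwo e) 1 1)⁻¹‖ * ‖etaTwoIntegrand (hermTwo ((1 / 4 : ℝ) • d₀)) (hermTwo e) α (β + 1) c‖) +
      K * B * ‖etaTwoIntegrand (hermTwo ((1 / 4 : ℝ) • d₀)) (hermTwo e) α (β + 1) c‖)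
    (Metric.ball_mem_nhds t₀ hεpos) ?_ ?_ ?_ ?_ ?_ ?_).2
  · exact Filter.Eventually.of_forall fun t => aestronglyMeasurable_etaShiftIntegrand _ (hermTwo e) _ _ _
  · -- integrability at `t₀` (dominated `G`)
    exact integrableOn_etaShiftIntegrand_of_dominated hg2 hH (fun c hc => (hdom t₀ ht₀.le c (hcone c hc)).1) α hβ
  · -- measurability of `F' t₀`
    have h11' : Measurable fun c : ℝ × ℂ × ℝ => (hermTwo c - hermTwo e) 1 1 := by
      simp_rw [hermTwo_sub_apply_one_one]
      fun_prop
    exact (((measurable_const.div h11').mul (measurable_etaTwoIntegrand _ (hermTwo e) _ _)).add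
      ((continuous_trace_hermTwo_mul Ξ).measurable.neg.mul (measurable_etaShiftIntegrand _ (hermTwo e) _ _))).aestronglyMeasurable
  · -- THE DOMINATION on the ball
    refine (ae_restrict_iff' (measurableSet_etaTwoSet hH.1)).mpr (Filter.Eventually.of_forall fun c hc t ht => ?_)
    have htr := hball t ht
    obtain ⟨hd1, hd2⟩ := hdom t htr c (hcone c hc)
    obtain ⟨-, hcm⟩ := (mem_etaTwoSet_iff (hermTwo e) c).mp hc
    have hbt : 0 < c.2.2 - e.2.2 := sub_snd_pos_of_mem hcm
    have hWn : ‖((hermTwo c - hermTwo e) 1 1)⁻¹‖ = (c.2.2 - e.2.2)⁻¹ := by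
      rw [hermTwo_sub_apply_one_one, hermTwo_apply_one_one, ← Complex.ofReal_sub, norm_inv, Complex.norm_of_nonneg hbt.le]
    -- first term
    have hT1 : ‖Ξ 0 0 / ((hermTwo c - hermTwo e) 1 1 : ℂ) * etaTwoIntegrand (hermTwo d₀ + t • Ξ) (hermTwo e) α (β + 1) c‖ ≤
        ‖Ξ 0 0‖ * (‖((hermTwo c - hermTwo e) 1 1 : ℂ)⁻¹‖ * ‖etaTwoIntegrand (hermTwo ((1 / 2 : ℝ) • d₀)) (hermTwo e) α (β + 1) c‖) := by
      have hE1 := norm_etaTwoIntegrand_le_of_dominated (h := hermTwo e) hd1 α (β + 1)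
      have heq : ‖Ξ 0 0 / ((hermTwo c - hermTwo e) 1 1 : ℂ) * etaTwoIntegrand (hermTwo d₀ + t • Ξ) (hermTwo e) α (β + 1) c‖ =
          ‖Ξ 0 0‖ * (‖((hermTwo c - hermTwo e) 1 1 : ℂ)⁻¹‖ * ‖etaTwoIntegrand (hermTwo d₀ + t • Ξ) (hermTwo e) α (β + 1) c‖) := by
        rw [norm_mul, norm_div, div_eq_mul_inv, norm_inv, mul_assoc]
      rw [heq]
      exact mul_le_mul_of_nonneg_left (mul_le_mul_of_nonneg_left hE1 (norm_nonneg _)) (norm_nonneg _)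
    -- second term: the weight of `G₀ + tΞ`, then `|tr(xΞ)| e^{−tr x(G₀+tΞ)} ≤ K e^{−tr x G₀/4}`
    have hQ : ‖etaShiftWeight (hermTwo d₀ + t • Ξ) (hermTwo e) α c‖ ≤ A * (c.2.2 - e.2.2)⁻¹ + B := by
      refine (norm_etaShiftWeight_le (hermTwo d₀ + t • Ξ) hH hcm α).trans ?_
      rw [← hδdef, hA, hB, apply_param]
      have h1 : ‖hermTwo d₀ 0 0 + t * Ξ 0 0‖ ≤ ‖hermTwo d₀ 0 0‖ + r * ‖Ξ 0 0‖ := by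
        refine (norm_add_le _ _).trans ?_
        rw [norm_mul]
        exact add_le_add le_rfl (mul_le_mul_of_nonneg_right htr (norm_nonneg _))
      have h2 : ‖hermTwo d₀ 0 0 + t * Ξ 0 0‖ + 2 * e.2.2 * ‖α - 2‖ / δ ≤ ‖hermTwo d₀ 0 0‖ + r * ‖Ξ 0 0‖ + 2 * e.2.2 * ‖α - 2‖ / δ := by linarith
      exact add_le_add (mul_le_mul_of_nonneg_right h2 (inv_nonneg.mpr hbt.le)) le_rfl
    have hdet : ∀ γ : ℂ, ‖etaTwoIntegrand (hermTwo d₀ + t • Ξ) (hermTwo e) α γ c‖ * ‖(hermTwo c * Ξ).trace‖ ≤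
        K * ‖etaTwoIntegrand (hermTwo ((1 / 4 : ℝ) • d₀)) (hermTwo e) α γ c‖ := by
      intro γ
      have e1 : ‖etaTwoIntegrand (hermTwo d₀ + t • Ξ) (hermTwo e) α γ c‖ = ‖cexp (-(hermTwo c * (hermTwo d₀ + t • Ξ)).trace)‖ *
          ‖(hermTwo c + hermTwo e).det ^ (α - 2) * (hermTwo c - hermTwo e).det ^ (γ - 2)‖ := by
        rw [etaTwoIntegrand_apply, norm_mul]
      have e2 : ‖etaTwoIntegrand (hermTwo ((1 / 4 : ℝ) • d₀)) (hermTwo e) α γ c‖ = ‖cexp (-(hermTwo c * hermTwo ((1 / 4 : ℝ) • d₀)).trace)‖ *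
          ‖(hermTwo c + hermTwo e).det ^ (α - 2) * (hermTwo c - hermTwo e).det ^ (γ - 2)‖ := by
        rw [etaTwoIntegrand_apply, norm_mul]
      rw [e1, e2]
      calc ‖cexp (-(hermTwo c * (hermTwo d₀ + t • Ξ)).trace)‖ * ‖(hermTwo c + hermTwo e).det ^ (α - 2) * (hermTwo c - hermTwo e).det ^ (γ - 2)‖ *
            ‖(hermTwo c * Ξ).trace‖
          = (‖(hermTwo c * Ξ).trace‖ * ‖cexp (-(hermTwo c * (hermTwo d₀ + t • Ξ)).trace)‖) *
              ‖(hermTwo c + hermTwo e).det ^ (α - 2) * (hermTwo c - hermTwo e).det ^ (γ - 2)‖ := by ring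
        _ ≤ (K * ‖cexp (-(hermTwo c * hermTwo ((1 / 4 : ℝ) • d₀)).trace)‖) *
              ‖(hermTwo c + hermTwo e).det ^ (α - 2) * (hermTwo c - hermTwo e).det ^ (γ - 2)‖ := mul_le_mul_of_nonneg_right hd2 (norm_nonneg _)
        _ = _ := by ring
    have hT2 : ‖-(hermTwo c * Ξ).trace * etaShiftIntegrand (hermTwo d₀ + t • Ξ) (hermTwo e) α β c‖ ≤
        K * A * (‖((hermTwo c - hermTwo e) 1 1)⁻¹‖ * ‖etaTwoIntegrand (hermTwo ((1 / 4 : ℝ) • d₀)) (hermTwo e) α (β + 1) c‖) +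
          K * B * ‖etaTwoIntegrand (hermTwo ((1 / 4 : ℝ) • d₀)) (hermTwo e) α (β + 1) c‖ := by
      rw [norm_mul, norm_neg, etaShiftIntegrand_apply, norm_mul, hWn]
      have h := hdet (β + 1)
      have hN0 : 0 ≤ ‖etaTwoIntegrand (hermTwo ((1 / 4 : ℝ) • d₀)) (hermTwo e) α (β + 1) c‖ := norm_nonneg _
      calc ‖(hermTwo c * Ξ).trace‖ * (‖etaShiftWeight (hermTwo d₀ + t • Ξ) (hermTwo e) α c‖ *
            ‖etaTwoIntegrand (hermTwo d₀ + t • Ξ) (hermTwo e) α (β + 1) c‖)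
          = ‖etaShiftWeight (hermTwo d₀ + t • Ξ) (hermTwo e) α c‖ *
              (‖etaTwoIntegrand (hermTwo d₀ + t • Ξ) (hermTwo e) α (β + 1) c‖ * ‖(hermTwo c * Ξ).trace‖) := by ring
        _ ≤ (A * (c.2.2 - e.2.2)⁻¹ + B) * (K * ‖etaTwoIntegrand (hermTwo ((1 / 4 : ℝ) • d₀)) (hermTwo e) α (β + 1) c‖) :=
            mul_le_mul hQ h (mul_nonneg (norm_nonneg _) (norm_nonneg _)) (add_nonneg (mul_nonneg hA0 (inv_nonneg.mpr hbt.le)) hB0)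
        _ = _ := by ring
    exact (norm_add_le _ _).trans (add_le_add hT1 hT2) |>.trans (le_of_eq (by ring))
  · exact ((hW2.const_mul _).add (hW4.const_mul _)).add (hN4.const_mul _)
  · exact (ae_restrict_iff' (measurableSet_etaTwoSet hH.1)).mpr (Filter.Eventually.of_forall fun c _ t _ =>
      hasDerivAt_etaShiftIntegrand_param (hermTwo d₀) Ξ (hermTwo e) α β c t)

/-- **HOLOMORPHY ON THE DISC** (eta-level). -/
theorem differentiableOn_etaShift_param {d₀ : ℝ × ℂ × ℝ} (hd₀ : 0 < d₀.1 ∧ normSq d₀.2.1 < d₀.1 * d₀.2.2) (Ξ : Matrix (Fin 2) (Fin 2) ℂ)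
    {H : Matrix (Fin 2) (Fin 2) ℂ} (hH : H.PosDef) {r K : ℝ}
    (hdom : ∀ t : ℂ, ‖t‖ ≤ r → ∀ c : ℝ × ℂ × ℝ, (0 < c.1 ∧ normSq c.2.1 < c.1 * c.2.2) →
      ‖cexp (-(hermTwo c * (hermTwo d₀ + t • Ξ)).trace)‖ ≤ ‖cexp (-(hermTwo c * hermTwo ((1 / 2 : ℝ) • d₀)).trace)‖ ∧
      ‖(hermTwo c * Ξ).trace‖ * ‖cexp (-(hermTwo c * (hermTwo d₀ + t • Ξ)).trace)‖ ≤
        K * ‖cexp (-(hermTwo c * hermTwo ((1 / 4 : ℝ) • d₀)).trace)‖)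
    (α : ℂ) {β : ℂ} (hβ : 0 < β.re) :
    DifferentiableOn ℂ (fun t : ℂ => etaShift (hermTwo d₀ + t • Ξ) H α β) (Metric.ball 0 r) := fun t ht =>
  (hasDerivAt_etaShift_param hd₀ Ξ hH hdom α hβ (by simpa using ht)).differentiableAt.differentiableWithinAt

/-! ## The `Ξ`-line of `xiShift` -/

/-- `2 • (g₀ + t•Ξ) = hermTwo (2 • d) + t • (2 • Ξ)` for `g₀ = hermTwo d`. -/
theorem two_smul_param (d : ℝ × ℂ × ℝ) (Ξ : Matrix (Fin 2) (Fin 2) ℂ) (t : ℂ) :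
    (2 : ℂ) • (hermTwo d + t • Ξ) = hermTwo ((2 : ℝ) • d) + t • ((2 : ℂ) • Ξ) := by
  rw [smul_add, hermTwo_smul, smul_comm]
  norm_num

/-- **`t ↦ xiShift (g₀ + t•Ξ) h α β` IS HOLOMORPHIC ON A DISC AROUND `0`** (head of file (7b)): for `g₀, h > 0`, any direction `Ξ`, every `α`
and `re β > 0` there are `r > 0`, `K ≥ 0` with the DOMINATION CERTIFICATE of `2(g₀ + tΞ)` on `‖t‖ ≤ r` (by `g₀`, and by `g₀∕2` with the
weight `|tr(x·2Ξ)|`) and `DifferentiableOn ℂ (fun t => xiShift (g₀ + t•Ξ) h α β) (ball 0 r)`; `r, K` depend on `g₀, Ξ` only. -/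
theorem exists_differentiableOn_xiShift_param {d : ℝ × ℂ × ℝ} (hd : 0 < d.1 ∧ normSq d.2.1 < d.1 * d.2.2) (Ξ : Matrix (Fin 2) (Fin 2) ℂ) :
    ∃ r K : ℝ, 0 < r ∧ 0 ≤ K ∧
      (∀ t : ℂ, ‖t‖ ≤ r → ∀ c : ℝ × ℂ × ℝ, (0 < c.1 ∧ normSq c.2.1 < c.1 * c.2.2) →
        ‖cexp (-(hermTwo c * (hermTwo ((2 : ℝ) • d) + t • ((2 : ℂ) • Ξ))).trace)‖ ≤
            ‖cexp (-(hermTwo c * hermTwo ((1 / 2 : ℝ) • ((2 : ℝ) • d))).trace)‖ ∧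
        ‖(hermTwo c * ((2 : ℂ) • Ξ)).trace‖ * ‖cexp (-(hermTwo c * (hermTwo ((2 : ℝ) • d) + t • ((2 : ℂ) • Ξ))).trace)‖ ≤
          K * ‖cexp (-(hermTwo c * hermTwo ((1 / 4 : ℝ) • ((2 : ℝ) • d))).trace)‖) ∧
      ∀ {h : Matrix (Fin 2) (Fin 2) ℂ}, h.PosDef → ∀ (α : ℂ) {β : ℂ}, 0 < β.re →
        DifferentiableOn ℂ (fun t : ℂ => xiShift (hermTwo d + t • Ξ) h α β) (Metric.ball 0 r) := by
  have hd2 : 0 < ((2 : ℝ) • d).1 ∧ normSq ((2 : ℝ) • d).2.1 < ((2 : ℝ) • d).1 * ((2 : ℝ) • d).2.2 :=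
    (posDef_hermTwo_iff _).mp (posDef_hermTwo_smul two_pos ((posDef_hermTwo_iff d).mpr hd))
  obtain ⟨r, K, hr, hK, hdom⟩ := exists_dominating_radius hd2 ((2 : ℂ) • Ξ)
  refine ⟨r, K, hr, hK, hdom, fun {h} hh α β hβ => ?_⟩
  have hη := differentiableOn_etaShift_param hd2 ((2 : ℂ) • Ξ) (posDef_pi_smul hh) hdom α hβ
  have hf : (fun t : ℂ => xiShift (hermTwo d + t • Ξ) h α β) = fun t =>
      ((4 * Real.pi ^ 4 : ℝ) : ℂ) * cexp ((Real.pi * I) * (β - α)) * (hermTwoGamma α)⁻¹ * ((Real.pi : ℂ) * Complex.Gamma β ^ 2)⁻¹ *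
        etaShift (hermTwo ((2 : ℝ) • d) + t • ((2 : ℂ) • Ξ)) ((Real.pi : ℂ) • h) α β := by
    funext t
    rw [xiShift_def, two_smul_param]
  rw [hf]
  exact hη.const_mul _

end Summit.HodgeConjecture.HodgeConjecture.Cruxes.HLiu418.K2LiuHermTwoXiShiftParamHolomorphy

end
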